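import Summits.RiemannHypothesis.RiemannHypothesis.Theorems.PfPersistenceGalerkinNesting
import HarnessLib

/-!
# PF persistence — F3-S6 support: NESTED TRUNCATION LADDERS FOR ANY HOST (pub-rhpf fake-3, gen 5)

**HONEST FRAMING. This is a long-odds MECHANISM / RIGIDITY campaign; no RH claims.** Everything in this
file is RH-free, unconditional, finite-dimensional linear algebra; no DATA enters and nothing here is
specific to `ζ`.

The tree's nesting law `bottomRayleigh_antitone` (`PfPersistenceGalerkinNesting` §1) is stated for the even
blocks `datumOf w ⟨a, N, ha⟩` — `ζ`'s polar and archimedean parts with an arbitrary prime weight table `w`.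
The window matrices of the fake-3 comparison objects (Epstein zeta functions of imaginary quadratic orders,
Hecke `L`-functions; host `ζ_K` with a `Γ_ℂ` archimedean factor and a conductor term, FAKES §3.7–3.10) are NOT
of that form, but their truncation ladders are nested all the same, for the reason recorded in
`datumOf_succ_castSucc`: a window-matrix entry `W(Θ_{nm}^{(a)})` is a host functional applied to a test that
depends on `(a, n, m)` and not on the truncation rank `N`. This file records the generic statement the
F3-S6 `N`-axis certificates are read through (FAKES 3.8.2 / §3.10: "PSD at `(a, N)` ⇒ PSD at every
`N' ≤ N`; negative at `(a, N)` ⇒ negative at every `N' ≥ N`"):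

* §1 CORNER MONOTONICITY (PROVED, any real square matrix): the bottom Rayleigh value of a matrix is at most
  that of its leading principal corner (`bottomRayleigh_le_corner`).
* §2 LADDERS (PROVED): a ladder is one real `(N+1) × (N+1)` block per rank `N`; it is NESTED when each
  block is the leading corner of the next. Along a nested ladder `N ↦ ε₁(M N)` is ANTITONE
  (`Ladder.antitone_of_nested`); the PSD ranks `{N | 0 ≤ ε₁}` and `{N | 0 < ε₁}` are LOWER sets and the
  negative ranks `{N | ε₁ < 0}` an UPPER set (`isLowerSet_nonneg_of_nested`, `isLowerSet_pos_of_nested`, `isUpperSet_neg_of_nested`),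
  and there is a threshold rank `N₀ : ℕ∞` with `ε₁(M N) < 0 ↔ N₀ ≤ N` (`exists_threshold_of_nested`).
* §3 ENTRY-DEFINED LADDERS ARE NESTED (PROVED): `N ↦ Matrix.of (fun n m : Fin (N+1) ↦ f n m)` for any
  `f : ℕ → ℕ → ℝ` is nested by `rfl` on entries (`Ladder.nested_ofEntries`) — this is the case of every
  window family of the cell, whatever the host; and the tree's `datumOf w` ladders are nested
  (`datumOf_submatrix_castSucc`; threshold `exists_threshold_datumOf`).

What this does NOT say: nothing about where the threshold `N₀` sits for any particular object (that is
DATA, HOME/certs/fake3/f3s6/), nothing about odd blocks beyond the remark that they are entry-defined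
ladders too, and nothing about `ζ`.
-/

set_option linter.dupNamespace false  -- the mandated namespace repeats `RiemannHypothesis`

noncomputable section

open Set Matrix

namespace Summit.RiemannHypothesis.RiemannHypothesis.Theorems.PfPersistence

/-! ## §1 Corner monotonicity for any real square matrix -/

/-- PROVED: the Rayleigh set of the leading principal corner is contained in the Rayleigh set of the
matrix (zero-pad the vector). [folklore] -/
theorem rayleighSet_corner_subset {N : ℕ} (M : Matrix (Fin (N + 1 + 1)) (Fin (N + 1 + 1)) ℝ) :
    rayleighSet (M.submatrix Fin.castSucc Fin.castSucc) ⊆ rayleighSet M := by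
  rintro r ⟨v, hv, rfl⟩
  exact ⟨Fin.snoc v 0, snoc_zero_ne_zero hv, by rw [snoc_zero_form, snoc_zero_dotProduct]⟩

/-- **PROVED — `ε₁(M) ≤ ε₁(leading corner of M)`** for every real square matrix of size `≥ 2`:
enlarging a block by one row and column can only lower the bottom Rayleigh value. [folklore] -/
theorem bottomRayleigh_le_corner {N : ℕ} (M : Matrix (Fin (N + 1 + 1)) (Fin (N + 1 + 1)) ℝ) :
    bottomRayleigh M ≤ bottomRayleigh (M.submatrix Fin.castSucc Fin.castSucc) := by
  rw [bottomRayleigh_eq_sInf, bottomRayleigh_eq_sInf]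
  exact csInf_le_csInf (rayleighSet_bddBelow _) (rayleighSet_nonempty _) (rayleighSet_corner_subset M)

/-! ## §2 Truncation ladders -/

namespace Ladder

/-! A truncation LADDER of window matrices is a family `M : (N : ℕ) → Matrix (Fin (N+1)) (Fin (N+1)) ℝ`,
one real block per truncation rank `N` (the served `N`-axis of the cell's census: `eps1_*(a, N)` is
`bottomRayleigh (M N)`). It is NESTED when the rank-`N` block is the leading principal corner of the
rank-`N+1` block: hypothesis `h : ∀ N, (M (N + 1)).submatrix Fin.castSucc Fin.castSucc = M N` below (kept as
an explicit hypothesis rather than a named predicate, so that this file adds no definitions). -/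

variable {M : (N : ℕ) → Matrix (Fin (N + 1)) (Fin (N + 1)) ℝ}

/-- PROVED: one rung — `ε₁(M (N+1)) ≤ ε₁(M N)`. [folklore] -/
theorem succ_le_of_nested (h : ∀ N : ℕ, (M (N + 1)).submatrix Fin.castSucc Fin.castSucc = M N) (N : ℕ) : bottomRayleigh (M (N + 1)) ≤ bottomRayleigh (M N) := by
  have := bottomRayleigh_le_corner (M (N + 1))
  rwa [h N] at this

/-- **PROVED — along a nested ladder the bottom Rayleigh value is ANTITONE in the rank.** [folklore] -/
theorem antitone_of_nested (h : ∀ N : ℕ, (M (N + 1)).submatrix Fin.castSucc Fin.castSucc = M N) : Antitone fun N : ℕ ↦ bottomRayleigh (M N) :=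
  antitone_nat_of_succ_le (succ_le_of_nested h)

/-- PROVED: `N ≤ N'` ⇒ `ε₁(M N') ≤ ε₁(M N)`. [folklore] -/
theorem le_of_le_of_nested (h : ∀ N : ℕ, (M (N + 1)).submatrix Fin.castSucc Fin.castSucc = M N) {N N' : ℕ} (hNN' : N ≤ N') :
    bottomRayleigh (M N') ≤ bottomRayleigh (M N) :=
  antitone_of_nested h hNN'

/-- **PROVED — DOWNWARD PERSISTENCE OF A PSD CERTIFICATE**: `0 ≤ ε₁` at rank `N'` gives `0 ≤ ε₁` at
every rank `N ≤ N'`. [folklore] -/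
theorem nonneg_of_le_of_nested (h : ∀ N : ℕ, (M (N + 1)).submatrix Fin.castSucc Fin.castSucc = M N) {N N' : ℕ} (hNN' : N ≤ N') (hN' : 0 ≤ bottomRayleigh (M N')) :
    0 ≤ bottomRayleigh (M N) :=
  hN'.trans (le_of_le_of_nested h hNN')

/-- PROVED: the strict version — `0 < ε₁` at rank `N'` gives `0 < ε₁` at every `N ≤ N'`. [folklore] -/
theorem pos_of_le_of_nested (h : ∀ N : ℕ, (M (N + 1)).submatrix Fin.castSucc Fin.castSucc = M N) {N N' : ℕ} (hNN' : N ≤ N') (hN' : 0 < bottomRayleigh (M N')) :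
    0 < bottomRayleigh (M N) :=
  hN'.trans_le (le_of_le_of_nested h hNN')

/-- **PROVED — UPWARD PERSISTENCE OF A NEGATIVITY CERTIFICATE**: `ε₁ < 0` at rank `N` gives `ε₁ < 0` at
every rank `N' ≥ N`. [folklore] -/
theorem neg_of_le_of_nested (h : ∀ N : ℕ, (M (N + 1)).submatrix Fin.castSucc Fin.castSucc = M N) {N N' : ℕ} (hNN' : N ≤ N') (hN : bottomRayleigh (M N) < 0) :
    bottomRayleigh (M N') < 0 :=
  (le_of_le_of_nested h hNN').trans_lt hN

/-- PROVED: the PSD ranks form a lower set. [folklore] -/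
theorem isLowerSet_nonneg_of_nested (h : ∀ N : ℕ, (M (N + 1)).submatrix Fin.castSucc Fin.castSucc = M N) : IsLowerSet {N : ℕ | 0 ≤ bottomRayleigh (M N)} :=
  fun _ _ hle hN' ↦ nonneg_of_le_of_nested h hle hN'

/-- PROVED: the strictly-PSD ranks form a lower set. [folklore] -/
theorem isLowerSet_pos_of_nested (h : ∀ N : ℕ, (M (N + 1)).submatrix Fin.castSucc Fin.castSucc = M N) : IsLowerSet {N : ℕ | 0 < bottomRayleigh (M N)} :=
  fun _ _ hle hN' ↦ pos_of_le_of_nested h hle hN'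

/-- PROVED: the negative ranks form an upper set. [folklore] -/
theorem isUpperSet_neg_of_nested (h : ∀ N : ℕ, (M (N + 1)).submatrix Fin.castSucc Fin.castSucc = M N) : IsUpperSet {N : ℕ | bottomRayleigh (M N) < 0} :=
  fun _ _ hle hN ↦ neg_of_le_of_nested h hle hN

/-- **PROVED — THE `N`-ONSET IS A THRESHOLD.** Along a nested ladder there is `N₀ : ℕ∞` (`⊤` = never) with
`ε₁(M N) < 0 ↔ N₀ ≤ N` for every rank `N`: negativity, once certified at one rank, holds at all larger
ranks, and a PSD certificate at one rank covers all smaller ranks. [folklore] -/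
theorem exists_threshold_of_nested (h : ∀ N : ℕ, (M (N + 1)).submatrix Fin.castSucc Fin.castSucc = M N) :
    ∃ N₀ : ℕ∞, ∀ N : ℕ, bottomRayleigh (M N) < 0 ↔ N₀ ≤ (N : ℕ∞) := by
  classical
  by_cases hS : ∃ N : ℕ, bottomRayleigh (M N) < 0
  · refine ⟨(Nat.find hS : ℕ), fun N ↦ ⟨fun hN ↦ ?_, fun hN ↦ ?_⟩⟩
    · exact_mod_cast Nat.find_min' hS hN
    · exact neg_of_le_of_nested h (by exact_mod_cast hN) (Nat.find_spec hS)
  · push Not at hS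
    refine ⟨⊤, fun N ↦ ⟨fun hN ↦ absurd hN (not_lt.2 (hS N)), fun hN ↦ ?_⟩⟩
    exact absurd hN (by simp)

/-! ## §3 Entry-defined ladders are nested -/

/-- **PROVED — ENTRY-DEFINED LADDERS ARE NESTED**: the ladder whose rank-`N` block has entries `f n m`
INDEPENDENT of `N` — the shape of every window family of the cell (entry = host functional applied to the
test `Θ_{nm}^{(a)}`, whatever the host) — is nested, hence all of §2 applies to it. [folklore] -/
theorem nested_ofEntries (f : ℕ → ℕ → ℝ) (N : ℕ) :
    (Matrix.of fun n m : Fin (N + 1 + 1) ↦ f n m).submatrix Fin.castSucc Fin.castSucc =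
      Matrix.of fun n m : Fin (N + 1) ↦ f n m := by
  ext n m
  simp

/-- PROVED: so their bottom Rayleigh values are antitone in the rank. [folklore] -/
theorem antitone_bottomRayleigh_ofEntries (f : ℕ → ℕ → ℝ) :
    Antitone fun N : ℕ ↦ bottomRayleigh (Matrix.of fun n m : Fin (N + 1) ↦ f n m) :=
  antitone_of_nested (M := fun N ↦ Matrix.of fun n m : Fin (N + 1) ↦ f n m) (nested_ofEntries f)

/-- PROVED: a PSD certificate at rank `N'` of an entry-defined ladder covers every rank `N ≤ N'`. [folklore] -/
theorem nonneg_of_le_ofEntries (f : ℕ → ℕ → ℝ) {N N' : ℕ} (hNN' : N ≤ N')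
    (hN' : 0 ≤ bottomRayleigh (Matrix.of fun n m : Fin (N' + 1) ↦ f n m)) :
    0 ≤ bottomRayleigh (Matrix.of fun n m : Fin (N + 1) ↦ f n m) :=
  nonneg_of_le_of_nested (M := fun N ↦ Matrix.of fun n m : Fin (N + 1) ↦ f n m) (nested_ofEntries f) hNN' hN'

/-- PROVED: a negativity certificate at rank `N` of an entry-defined ladder covers every rank `N' ≥ N`. [folklore] -/
theorem neg_of_le_ofEntries (f : ℕ → ℕ → ℝ) {N N' : ℕ} (hNN' : N ≤ N')
    (hN : bottomRayleigh (Matrix.of fun n m : Fin (N + 1) ↦ f n m) < 0) :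
    bottomRayleigh (Matrix.of fun n m : Fin (N' + 1) ↦ f n m) < 0 :=
  neg_of_le_of_nested (M := fun N ↦ Matrix.of fun n m : Fin (N + 1) ↦ f n m) (nested_ofEntries f) hNN' hN

/-- PROVED: and their negative ranks have a threshold. [folklore] -/
theorem exists_threshold_ofEntries (f : ℕ → ℕ → ℝ) :
    ∃ N₀ : ℕ∞, ∀ N : ℕ, bottomRayleigh (Matrix.of fun n m : Fin (N + 1) ↦ f n m) < 0 ↔ N₀ ≤ (N : ℕ∞) :=
  exists_threshold_of_nested (M := fun N ↦ Matrix.of fun n m : Fin (N + 1) ↦ f n m) (nested_ofEntries f)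

end Ladder

/-- PROVED: the tree's even-block ladders `N ↦ datumOf w ⟨a, N, ha⟩` are nested (`datumOf_submatrix_castSucc`,
so `Ladder.antitone_of_nested` recovers `bottomRayleigh_antitone`), hence the `N`-onset of negativity of
`ε₁^{(N)}(a)` is a threshold, for every weight table. [folklore] -/
theorem exists_threshold_datumOf (w : Weights) (a : ℝ) (ha : 0 < a) :
    ∃ N₀ : ℕ∞, ∀ N : ℕ, bottomRayleigh (datumOf w ⟨a, N, ha⟩) < 0 ↔ N₀ ≤ (N : ℕ∞) :=
  Ladder.exists_threshold_of_nested (M := fun N ↦ datumOf w ⟨a, N, ha⟩) (datumOf_submatrix_castSucc w a ha)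


end Summit.RiemannHypothesis.RiemannHypothesis.Theorems.PfPersistence

end
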